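import Summits.Ventures.PercRepro.C026TwoHubOpen

/-!
# THEOREM B without the terminal edge, concluded: `(G⅔)` and THEOREM L2 on the two-hub class with
NON-ADJACENT terminals (p6, gen 22)

On `H₀ = G.attachTwoHubOpen a b h h'` (C026TwoHubOpen: the hub graph `G` plus the four hub edges,
no terminal edge) ROW C-041 `(G⅔)` follows from THEOREM B on `H = G.attachTwoHub a b h h'`
(C026TwoHubMain, `twoHub_goodDegree`): extension by a red terminal edge injects the sources of `H₀`
into those of `H` (`card_DA_open_le`), and restriction injects the `Good_t` sources of `H` into those
of `H₀` (`card_goodA_le_open`, `card_goodB_le_open`, from `restrict_goodA_of_goodA` and its mirror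
`restrict_goodB_of_goodB` here), so

  `2·n(D,A)(H₀) ≤ 2·n(D,A)(H) ≤ 3·(#Good_a(H) + #Good_b(H)) ≤ 3·(#Good_a(H₀) + #Good_b(H₀))`

(`twoHubOpen_goodDegree`), and THEOREM L2 holds on the open two-hub class
(`pFun_threeCells_nonneg_twoHubOpen`).  The smallest 2-connected skeleton with Bad sources —
`K₂,₃` with the probe and the two live vertices on the 3-side (6 Bad among 13 sources) — is the
case `G = {c–h, c–h'}`.
-/

namespace PercRepro

namespace MultiGraph

open Finset

variable {V E : Type*} {G : MultiGraph V E} {a b h h' c : V}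

section Transfer

variable (hab : a ≠ b) (hca : c ≠ a) (hcb : c ≠ b) (hha : h ≠ a) (hhb : h ≠ b) (hh'a : h' ≠ a)
  (hh'b : h' ≠ b) (hisoa : ∀ e, G.fst e ≠ a ∧ G.snd e ≠ a) (hisob : ∀ e, G.fst e ≠ b ∧ G.snd e ≠ b)

include hab hca hcb hha hhb hh'a hh'b hisoa hisob in
/-- **A `Good_b` source of `H` restricts to a `Good_b` source of the open skeleton** (the mirror of
`restrict_goodA_of_goodA`). -/
theorem restrict_goodB_of_goodB {S : Config (E ⊕ Fin 5)}
    (hS : ((G.attachTwoHub a b h h').Conn S c a ∧ (G.attachTwoHub a b h h').Conn S c b) ∧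
      (¬ (G.attachTwoHub a b h h').Conn Sᶜ c a ∧ ¬ (G.attachTwoHub a b h h').Conn Sᶜ c b ∧
        ¬ (G.attachTwoHub a b h h').Conn Sᶜ a b))
    (hg : (G.attachTwoHub a b h h').WalkAvoiding S ((G.attachTwoHub a b h h').cluster Sᶜ b) c a) :
    (((G.attachTwoHubOpen a b h h').Conn (restrictOpen S) c a ∧
        (G.attachTwoHubOpen a b h h').Conn (restrictOpen S) c b) ∧
      (¬ (G.attachTwoHubOpen a b h h').Conn (restrictOpen S)ᶜ c a ∧
        ¬ (G.attachTwoHubOpen a b h h').Conn (restrictOpen S)ᶜ c b ∧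
        ¬ (G.attachTwoHubOpen a b h h').Conn (restrictOpen S)ᶜ a b)) ∧
      (G.attachTwoHubOpen a b h h').WalkAvoiding (restrictOpen S)
        ((G.attachTwoHubOpen a b h h').cluster (restrictOpen S)ᶜ b) c a := by
  have h4 : S (Sum.inr 4) = true := ((DA_attach_iff hab hca hcb hha hhb hh'a hh'b hisoa hisob S).1 hS).1
  have hext : extendOpen (restrictOpen S) = S := extendOpen_restrictOpen h4
  have hDb : (G.attachTwoHub a b h h').cluster Sᶜ b =
      (G.attachTwoHubOpen a b h h').cluster (restrictOpen S)ᶜ b := by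
    rw [← hext, cluster_compl_extendOpen, restrictOpen_extendOpen]
  have hg' := walkAvoiding_open_of_walkAvoiding_attach' (G := G) (h := h) (h' := h')
    (W := (G.attachTwoHub a b h h').cluster Sᶜ b)
    ((G.attachTwoHub a b h h').self_mem_cluster _ b) hg
  rw [hDb] at hg'
  have hcb' : (G.attachTwoHubOpen a b h h').Conn (restrictOpen S) c b := by
    have hca'' : c ∉ ({a} : Set V) := by simpa using hca
    obtain ⟨x, hx, w, hw, hwalk, hxw⟩ := exists_entry hg.2 hca'' (Set.mem_singleton a)
    rw [Set.mem_singleton_iff] at hw hx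
    rw [hw] at hxw
    have hwalk' : (G.attachTwoHub a b h h').WalkAvoiding S
        ((G.attachTwoHub a b h h').cluster Sᶜ b ∪ {a}) c x :=
      walkAvoiding_union_of_walkAvoiding hca'' hwalk hg.1
    have hxDb : x ∉ (G.attachTwoHub a b h h').cluster Sᶜ b := fun hmem =>
      hwalk'.not_mem_right (Or.inl hmem)
    have hcx : (G.attachTwoHubOpen a b h h').Conn (restrictOpen S) c x :=
      (walkAvoiding_open_of_walkAvoiding_attach' (G := G) (h := h) (h' := h')
        (Set.mem_union_left _ ((G.attachTwoHub a b h h').self_mem_cluster _ b)) hwalk').conn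
    obtain ⟨f, hf, hend⟩ := hxw.1
    rcases f with e | i
    · exfalso
      rcases hend with ⟨_, h2⟩ | ⟨h1, _⟩
      · exact (hisoa e).2 h2
      · exact (hisoa e).1 h1
    · fin_cases i
      · rcases hend with ⟨h1, _⟩ | ⟨h1, _⟩
        · have hxh : x = h := (show h = x from h1).symm
          rw [hxh] at hcx hxDb
          have h1' : S (Sum.inr 1) = true := by
            by_contra h1'
            rw [Bool.not_eq_true] at h1'
            exact hxDb (subset_cluster_compl_b (Or.inl (Or.inr ⟨h1', G.self_mem_cluster _ h⟩)))
          exact hcx.trans (Conn.of_openAdj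
            ((G.attachTwoHubOpen a b h h').openAdj_of_open (Sum.inr 1) h1'))
        · exact absurd (show h = a from h1) hha
      · exfalso
        rcases hend with ⟨_, h2⟩ | ⟨h1, _⟩
        · exact hab (show b = a from h2).symm
        · exact hha (show h = a from h1)
      · rcases hend with ⟨h1, _⟩ | ⟨h1, _⟩
        · have hxh : x = h' := (show h' = x from h1).symm
          rw [hxh] at hcx hxDb
          have h3 : S (Sum.inr 3) = true := by
            by_contra h3
            rw [Bool.not_eq_true] at h3
            exact hxDb (subset_cluster_compl_b (Or.inr ⟨h3, G.self_mem_cluster _ h'⟩))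
          exact hcx.trans (Conn.of_openAdj
            ((G.attachTwoHubOpen a b h h').openAdj_of_open (Sum.inr 3) h3))
        · exact absurd (show h' = a from h1) hh'a
      · exfalso
        rcases hend with ⟨_, h2⟩ | ⟨h1, _⟩
        · exact hab (show b = a from h2).symm
        · exact hh'a (show h' = a from h1)
      · exfalso
        rcases hend with ⟨h1, _⟩ | ⟨_, h2⟩
        · exact hx (show a = x from h1).symm
        · exact hxDb ((show b = x from h2) ▸ (G.attachTwoHub a b h h').self_mem_cluster _ b)
  refine ⟨⟨⟨hg'.conn, hcb'⟩, ?_, ?_, ?_⟩, hg'⟩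
  · intro hc
    exact hS.2.1 (by rw [← hext]; exact conn_attach_of_conn_open (compl_extendOpen_map _) hc)
  · intro hc
    exact hS.2.2.1 (by rw [← hext]; exact conn_attach_of_conn_open (compl_extendOpen_map _) hc)
  · intro hc
    exact hS.2.2.2 (by rw [← hext]; exact conn_attach_of_conn_open (compl_extendOpen_map _) hc)

end Transfer

section Count

variable [Fintype E] [DecidableEq E]
variable (hab : a ≠ b) (hca : c ≠ a) (hcb : c ≠ b) (hha : h ≠ a) (hhb : h ≠ b) (hh'a : h' ≠ a)
  (hh'b : h' ≠ b) (hisoa : ∀ e, G.fst e ≠ a ∧ G.snd e ≠ a) (hisob : ∀ e, G.fst e ≠ b ∧ G.snd e ≠ b)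

open Classical in
/-- `n(D,A)(H₀) ≤ n(D,A)(H)`: extension by a red terminal edge injects the sources. -/
theorem card_DA_open_le :
    (univ.filter fun S₀ : Config (E ⊕ Fin 4) =>
        ((G.attachTwoHubOpen a b h h').Conn S₀ c a ∧ (G.attachTwoHubOpen a b h h').Conn S₀ c b) ∧
        (¬ (G.attachTwoHubOpen a b h h').Conn S₀ᶜ c a ∧ ¬ (G.attachTwoHubOpen a b h h').Conn S₀ᶜ c b ∧
          ¬ (G.attachTwoHubOpen a b h h').Conn S₀ᶜ a b)).card ≤
      (univ.filter fun S : Config (E ⊕ Fin 5) =>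
        ((G.attachTwoHub a b h h').Conn S c a ∧ (G.attachTwoHub a b h h').Conn S c b) ∧
        (¬ (G.attachTwoHub a b h h').Conn Sᶜ c a ∧ ¬ (G.attachTwoHub a b h h').Conn Sᶜ c b ∧
          ¬ (G.attachTwoHub a b h h').Conn Sᶜ a b)).card := by
  refine Finset.card_le_card_of_injOn extendOpen ?_ ?_
  · intro S₀ hS₀
    simp only [coe_filter, mem_univ, true_and, Set.mem_setOf_eq] at hS₀ ⊢
    exact DA_extend hS₀
  · intro S₀ _ S₀' _ hEq
    rw [← restrictOpen_extendOpen S₀, ← restrictOpen_extendOpen S₀', hEq]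

include hab hca hcb hha hhb hh'a hh'b hisoa hisob in
open Classical in
/-- `#Good_a(H) ≤ #Good_a(H₀)`: restriction injects the `Good_a` sources. -/
theorem card_goodA_le_open :
    (univ.filter fun S : Config (E ⊕ Fin 5) =>
        (((G.attachTwoHub a b h h').Conn S c a ∧ (G.attachTwoHub a b h h').Conn S c b) ∧
        (¬ (G.attachTwoHub a b h h').Conn Sᶜ c a ∧ ¬ (G.attachTwoHub a b h h').Conn Sᶜ c b ∧
          ¬ (G.attachTwoHub a b h h').Conn Sᶜ a b)) ∧
        (G.attachTwoHub a b h h').WalkAvoiding S ((G.attachTwoHub a b h h').cluster Sᶜ a) c b).card ≤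
      (univ.filter fun S₀ : Config (E ⊕ Fin 4) =>
        (((G.attachTwoHubOpen a b h h').Conn S₀ c a ∧ (G.attachTwoHubOpen a b h h').Conn S₀ c b) ∧
        (¬ (G.attachTwoHubOpen a b h h').Conn S₀ᶜ c a ∧ ¬ (G.attachTwoHubOpen a b h h').Conn S₀ᶜ c b ∧
          ¬ (G.attachTwoHubOpen a b h h').Conn S₀ᶜ a b)) ∧
        (G.attachTwoHubOpen a b h h').WalkAvoiding S₀
          ((G.attachTwoHubOpen a b h h').cluster S₀ᶜ a) c b).card := by
  refine Finset.card_le_card_of_injOn restrictOpen ?_ ?_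
  · intro S hS
    simp only [coe_filter, mem_univ, true_and, Set.mem_setOf_eq] at hS ⊢
    exact restrict_goodA_of_goodA hab hca hcb hha hhb hh'a hh'b hisoa hisob hS.1 hS.2
  · intro S hS S' hS' hEq
    simp only [coe_filter, mem_univ, true_and, Set.mem_setOf_eq] at hS hS'
    have h4 := ((DA_attach_iff hab hca hcb hha hhb hh'a hh'b hisoa hisob S).1 hS.1).1
    have h4' := ((DA_attach_iff hab hca hcb hha hhb hh'a hh'b hisoa hisob S').1 hS'.1).1
    rw [← extendOpen_restrictOpen h4, ← extendOpen_restrictOpen h4', hEq]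

include hab hca hcb hha hhb hh'a hh'b hisoa hisob in
open Classical in
/-- `#Good_b(H) ≤ #Good_b(H₀)`. -/
theorem card_goodB_le_open :
    (univ.filter fun S : Config (E ⊕ Fin 5) =>
        (((G.attachTwoHub a b h h').Conn S c a ∧ (G.attachTwoHub a b h h').Conn S c b) ∧
        (¬ (G.attachTwoHub a b h h').Conn Sᶜ c a ∧ ¬ (G.attachTwoHub a b h h').Conn Sᶜ c b ∧
          ¬ (G.attachTwoHub a b h h').Conn Sᶜ a b)) ∧
        (G.attachTwoHub a b h h').WalkAvoiding S ((G.attachTwoHub a b h h').cluster Sᶜ b) c a).card ≤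
      (univ.filter fun S₀ : Config (E ⊕ Fin 4) =>
        (((G.attachTwoHubOpen a b h h').Conn S₀ c a ∧ (G.attachTwoHubOpen a b h h').Conn S₀ c b) ∧
        (¬ (G.attachTwoHubOpen a b h h').Conn S₀ᶜ c a ∧ ¬ (G.attachTwoHubOpen a b h h').Conn S₀ᶜ c b ∧
          ¬ (G.attachTwoHubOpen a b h h').Conn S₀ᶜ a b)) ∧
        (G.attachTwoHubOpen a b h h').WalkAvoiding S₀
          ((G.attachTwoHubOpen a b h h').cluster S₀ᶜ b) c a).card := by
  refine Finset.card_le_card_of_injOn restrictOpen ?_ ?_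
  · intro S hS
    simp only [coe_filter, mem_univ, true_and, Set.mem_setOf_eq] at hS ⊢
    exact restrict_goodB_of_goodB hab hca hcb hha hhb hh'a hh'b hisoa hisob hS.1 hS.2
  · intro S hS S' hS' hEq
    simp only [coe_filter, mem_univ, true_and, Set.mem_setOf_eq] at hS hS'
    have h4 := ((DA_attach_iff hab hca hcb hha hhb hh'a hh'b hisoa hisob S).1 hS.1).1
    have h4' := ((DA_attach_iff hab hca hcb hha hhb hh'a hh'b hisoa hisob S').1 hS'.1).1
    rw [← extendOpen_restrictOpen h4, ← extendOpen_restrictOpen h4', hEq]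

include hab hca hcb hha hhb hh'a hh'b hisoa hisob in
open Classical in
/-- **THEOREM B WITHOUT THE TERMINAL EDGE**: ROW C-041 `(G⅔)` holds on every two-hub skeleton with
non-adjacent terminals `H₀ = G.attachTwoHubOpen a b h h'`: `2·n(D,A) ≤ 3·(#Good_a + #Good_b)`. -/
theorem twoHubOpen_goodDegree :
    2 * (univ.filter fun S₀ : Config (E ⊕ Fin 4) =>
        ((G.attachTwoHubOpen a b h h').Conn S₀ c a ∧ (G.attachTwoHubOpen a b h h').Conn S₀ c b) ∧
        (¬ (G.attachTwoHubOpen a b h h').Conn S₀ᶜ c a ∧ ¬ (G.attachTwoHubOpen a b h h').Conn S₀ᶜ c b ∧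
          ¬ (G.attachTwoHubOpen a b h h').Conn S₀ᶜ a b)).card ≤
      3 * ((univ.filter fun S₀ : Config (E ⊕ Fin 4) =>
          (((G.attachTwoHubOpen a b h h').Conn S₀ c a ∧ (G.attachTwoHubOpen a b h h').Conn S₀ c b) ∧
          (¬ (G.attachTwoHubOpen a b h h').Conn S₀ᶜ c a ∧
            ¬ (G.attachTwoHubOpen a b h h').Conn S₀ᶜ c b ∧
            ¬ (G.attachTwoHubOpen a b h h').Conn S₀ᶜ a b)) ∧
          (G.attachTwoHubOpen a b h h').WalkAvoiding S₀
            ((G.attachTwoHubOpen a b h h').cluster S₀ᶜ a) c b).card +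
        (univ.filter fun S₀ : Config (E ⊕ Fin 4) =>
          (((G.attachTwoHubOpen a b h h').Conn S₀ c a ∧ (G.attachTwoHubOpen a b h h').Conn S₀ c b) ∧
          (¬ (G.attachTwoHubOpen a b h h').Conn S₀ᶜ c a ∧
            ¬ (G.attachTwoHubOpen a b h h').Conn S₀ᶜ c b ∧
            ¬ (G.attachTwoHubOpen a b h h').Conn S₀ᶜ a b)) ∧
          (G.attachTwoHubOpen a b h h').WalkAvoiding S₀
            ((G.attachTwoHubOpen a b h h').cluster S₀ᶜ b) c a).card) := by
  have h1 := card_DA_open_le (G := G) (a := a) (b := b) (h := h) (h' := h') (c := c)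
  have h2 := twoHub_goodDegree (G := G) hab hca hcb hha hhb hh'a hh'b hisoa hisob
  have h3 := card_goodA_le_open hab hca hcb hha hhb hh'a hh'b hisoa hisob
  have h4 := card_goodB_le_open hab hca hcb hha hhb hh'a hh'b hisoa hisob
  omega

include hab hca hcb hha hhb hh'a hh'b hisoa hisob in
open Classical in
/-- **THEOREM L2 on the two-hub class with non-adjacent terminals**: CONJECTURE (P) at every band
state of the probe and the two live vertices on `G.attachTwoHubOpen a b h h'`. -/
theorem pFun_threeCells_nonneg_twoHubOpen [Fintype V] [DecidableEq V]
    {z κ x₁ K₁ x₂ K₂ : ℝ} (hz : 0 ≤ z ∧ z ≤ 1) (hκ : kMin z ≤ κ) (hx₁ : 0 ≤ x₁ ∧ x₁ ≤ 1)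
    (hx₂ : 0 ≤ x₂ ∧ x₂ ≤ 1) (hK₁ : kMin x₁ ≤ K₁) (hK₂ : kMin x₂ ≤ K₂) :
    0 ≤ (G.attachTwoHubOpen a b h h').pFun c (threeCells c a b z x₁ x₂)
      (threeCells c a b κ K₁ K₂) univ :=
  pFun_threeCells_nonneg_of_goodDegree a b c
    (twoHubOpen_goodDegree hab hca hcb hha hhb hh'a hh'b hisoa hisob) hz hκ hx₁ hx₂ hK₁ hK₂

end Count

end MultiGraph

end PercRepro
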